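import Literature.Analysis.InverseSpectral.KreinStringProofs
import HarnessLib

/-!
# Kreĭn strings: positivity and monotonicity on the negative real axis

For a Kreĭn string `S[m, L]` and `z = -s ≤ 0` the Picard series defining `φ(x, -s) = ∑ₙ sⁿ φₙ(x)`
and `ψ(x, -s) = ∑ₙ sⁿ ψₙ(x)` (`KreinString.phi`, `KreinString.psi`) have non-negative terms. Hence
(Kac–Kreĭn 1974 §1; Tomisaki 1988 §4, proof of Prop. 4.1: "`φ₁(x,s)` is nondecreasing in
`x ≥ 0`", "`φ₁(x,s) ≥ 1`", "`s ∫₀ˣ m(y) dy ≤ φ₁(x,s) - 1`"):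

* `φ(x, -s)`, `ψ(x, -s)` are real (`phi_neg_im`, `psi_neg_im`);
* `φ(x, -s) ≥ 1` and `ψ(x, -s) ≥ x` on `[0, L)` (`one_le_phi_neg_re`, `le_psi_neg_re`);
* `x ↦ φ(x, -s)` is non-decreasing on `[0, L)` (`monotoneOn_phi_neg_re`);
* the linear lower bound `φ(t, -s) ≥ 1 + s (t - a) m(a)` for `0 ≤ a ≤ t < L` (`phi_neg_re_ge`),
  which is what makes `∫₀^∞ φ(t,-s)⁻² dt` converge for a string with some mass;
* termwise domination `|φ(x, z)| ≤ φ(x, -|z|)`, `|ψ(x, z)| ≤ ψ(x, -|z|)` (`norm_phi_le`,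
  `norm_psi_le`).

These are the positivity inputs for the existence of the principal Titchmarsh–Weyl function on the
negative axis (part (i) of `KreinInverseSpectralTheorem`).

## References

KacKrein1974 (§1), Tomisaki1988 (§4).
-/

open MeasureTheory Filter Set Topology
open scoped ENNReal Nat

noncomputable section

namespace Literature.Analysis.InverseSpectral

namespace KreinString

variable (S : KreinString)

/-- `dm([0, a]) = dm((-∞, a])` since `dm` does not charge `(-∞, 0)`. [folklore] -/
lemma massMeasure_Icc_eq_Iic (a : ℝ) : S.massMeasure (Icc 0 a) = S.massMeasure (Iic a) := by
  rw [← Iic_sdiff_Iio, measure_sdiff_null S.massMeasure_Iio_zero]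

/-- `m(a) = dm([0, a])` (as a real number). [folklore] -/
lemma mass_eq_toReal_Icc (a : ℝ) : S.mass a = (S.massMeasure (Icc 0 a)).toReal := by
  rw [mass_def, massMeasure_Icc_eq_Iic]

/-- Picard iterates of a function non-negative on `[0, ∞)` are non-negative on `[0, ∞)`.
[folklore] -/
lemma picard_nonneg {f : ℝ → ℝ} (hf : ∀ x, 0 ≤ x → 0 ≤ f x) (n : ℕ) {x : ℝ} (hx : 0 ≤ x) :
    0 ≤ S.picard f n x := by
  induction n generalizing x with
  | zero => exact hf x hx
  | succ n ih =>
    rw [picard_succ]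
    exact setIntegral_nonneg measurableSet_Icc
      (fun t ht => mul_nonneg (sub_nonneg.2 ht.2) (ih ht.1))

/-- The Picard iterates `Kⁿ⁺¹ f` of a continuous `f ≥ 0` are non-decreasing on `[0, L)`.
[folklore] -/
lemma picard_succ_mono {f : ℝ → ℝ} (hf : Continuous f) (hf0 : ∀ x, 0 ≤ x → 0 ≤ f x) (n : ℕ)
    {x x' : ℝ} (hx : 0 ≤ x) (hxx' : x ≤ x') (hx' : x' ∈ S.dom) :
    S.picard f (n + 1) x ≤ S.picard f (n + 1) x' := by
  rw [picard_succ, picard_succ]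
  have hxd : x ∈ S.dom := ⟨hx, (ENNReal.ofReal_le_ofReal hxx').trans_lt hx'.2⟩
  have hcont : ContinuousOn (fun t => (x' - t) * S.picard f n t) (Icc 0 x') :=
    (continuousOn_const.sub continuousOn_id).mul (S.continuousOn_picard hx' hf.continuousOn n)
  have hint : IntegrableOn (fun t => (x' - t) * S.picard f n t) (Icc 0 x') S.massMeasure :=
    S.integrableOn_Icc_of_continuousOn hx' hcont
  calc ∫ t in Icc 0 x, (x - t) * S.picard f n t ∂S.massMeasure
      ≤ ∫ t in Icc 0 x, (x' - t) * S.picard f n t ∂S.massMeasure := by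
        refine setIntegral_mono_on ?_ (hint.mono_set (Icc_subset_Icc_right hxx')) measurableSet_Icc
          (fun t ht => mul_le_mul_of_nonneg_right (by linarith) (S.picard_nonneg hf0 n ht.1))
        exact S.integrableOn_Icc_of_continuousOn hxd ((continuousOn_const.sub continuousOn_id).mul
          ((S.continuousOn_picard hx' hf.continuousOn n).mono (Icc_subset_Icc_right hxx')))
    _ ≤ ∫ t in Icc 0 x', (x' - t) * S.picard f n t ∂S.massMeasure :=
        setIntegral_mono_set hint
          (ae_restrict_of_forall_mem measurableSet_Icc fun t ht =>
            mul_nonneg (sub_nonneg.2 ht.2) (S.picard_nonneg hf0 n ht.1))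
          (Icc_subset_Icc_right hxx').eventuallyLE

/-- At `z = -s` the Picard series of `φ` is a real series: `φ(x, -s) = ∑ₙ sⁿ φₙ(x)`. [folklore] -/
lemma phi_neg_ofReal (s x : ℝ) :
    S.phi (-(s : ℂ)) x = ((∑' n, s ^ n * S.picard (fun _ => (1 : ℝ)) n x : ℝ) : ℂ) := by
  rw [Complex.ofReal_tsum, phi_eq]
  push_cast
  simp only [neg_neg]

/-- At `z = -s` the Picard series of `ψ` is a real series: `ψ(x, -s) = ∑ₙ sⁿ ψₙ(x)`. [folklore] -/
lemma psi_neg_ofReal (s x : ℝ) :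
    S.psi (-(s : ℂ)) x = ((∑' n, s ^ n * S.picard (fun t => t) n x : ℝ) : ℂ) := by
  rw [Complex.ofReal_tsum, psi_eq]
  push_cast
  simp only [neg_neg]

/-- `φ(x, -s)` is real. [folklore] -/
lemma phi_neg_im (s x : ℝ) : (S.phi (-(s : ℂ)) x).im = 0 := by
  rw [phi_neg_ofReal, Complex.ofReal_im]

/-- `ψ(x, -s)` is real. [folklore] -/
lemma psi_neg_im (s x : ℝ) : (S.psi (-(s : ℂ)) x).im = 0 := by
  rw [psi_neg_ofReal, Complex.ofReal_im]

/-- `Re φ(x, -s) = ∑ₙ sⁿ φₙ(x)`. [folklore] -/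
lemma phi_neg_re (s x : ℝ) :
    (S.phi (-(s : ℂ)) x).re = ∑' n, s ^ n * S.picard (fun _ => (1 : ℝ)) n x := by
  rw [phi_neg_ofReal, Complex.ofReal_re]

/-- `Re ψ(x, -s) = ∑ₙ sⁿ ψₙ(x)`. [folklore] -/
lemma psi_neg_re (s x : ℝ) :
    (S.psi (-(s : ℂ)) x).re = ∑' n, s ^ n * S.picard (fun t => t) n x := by
  rw [psi_neg_ofReal, Complex.ofReal_re]

/-- The real Picard series `∑ₙ sⁿ (Kⁿ f)(x)` converges for `x ∈ [0, L)`. [folklore] -/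
lemma summable_picard_neg {f : ℝ → ℝ} (hf : Continuous f) (s : ℝ) {x : ℝ} (hx : x ∈ S.dom) :
    Summable (fun n => s ^ n * S.picard f n x) := by
  have h := S.summable_picard_term hf (-(s : ℂ)) hx
  simp only [neg_neg] at h
  refine Complex.summable_ofReal.1 ?_
  simpa using h

/-- `φ(x, -s) ≥ 1` for `s ≥ 0` and `x ∈ [0, L)`. [cite: Tomisaki1988, §4 (proof of Prop. 4.1)] -/
lemma one_le_phi_neg_re {s : ℝ} (hs : 0 ≤ s) {x : ℝ} (hx : x ∈ S.dom) :
    1 ≤ (S.phi (-(s : ℂ)) x).re := by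
  rw [phi_neg_re]
  have hsum := S.summable_picard_neg continuous_const s hx (f := fun _ => (1 : ℝ))
  calc (1 : ℝ) = s ^ 0 * S.picard (fun _ => (1 : ℝ)) 0 x := by simp
    _ ≤ ∑' n, s ^ n * S.picard (fun _ => (1 : ℝ)) n x :=
      hsum.le_tsum 0 (fun n _ =>
        mul_nonneg (pow_nonneg hs n) (S.picard_nonneg (fun _ _ => zero_le_one) n hx.1))

/-- `ψ(x, -s) ≥ x` for `s ≥ 0` and `x ∈ [0, L)`. [folklore] -/
lemma le_psi_neg_re {s : ℝ} (hs : 0 ≤ s) {x : ℝ} (hx : x ∈ S.dom) :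
    x ≤ (S.psi (-(s : ℂ)) x).re := by
  rw [psi_neg_re]
  have hsum := S.summable_picard_neg continuous_id s hx (f := fun t => t)
  calc x = s ^ 0 * S.picard (fun t => t) 0 x := by simp
    _ ≤ ∑' n, s ^ n * S.picard (fun t => t) n x :=
      hsum.le_tsum 0 (fun n _ =>
        mul_nonneg (pow_nonneg hs n) (S.picard_nonneg (fun _ h => h) n hx.1))

/-- `ψ(x, -s) ≥ 0` for `s ≥ 0` and `x ∈ [0, L)`. [folklore] -/
lemma psi_neg_re_nonneg {s : ℝ} (hs : 0 ≤ s) {x : ℝ} (hx : x ∈ S.dom) :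
    0 ≤ (S.psi (-(s : ℂ)) x).re :=
  hx.1.trans (S.le_psi_neg_re hs hx)

/-- `x ↦ φ(x, -s)` is non-decreasing on `[0, L)` for `s ≥ 0`.
[cite: Tomisaki1988, §4 (proof of Prop. 4.1)] -/
lemma monotoneOn_phi_neg_re {s : ℝ} (hs : 0 ≤ s) :
    MonotoneOn (fun x => (S.phi (-(s : ℂ)) x).re) S.dom := by
  intro x hx x' hx' hxx'
  simp only [phi_neg_re]
  refine (S.summable_picard_neg continuous_const s hx).tsum_le_tsum (fun n => ?_)
    (S.summable_picard_neg continuous_const s hx')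
  cases n with
  | zero => simp
  | succ n =>
    exact mul_le_mul_of_nonneg_left
      (S.picard_succ_mono continuous_const (fun _ _ => zero_le_one) n hx.1 hxx' hx')
      (pow_nonneg hs _)

/-- `x ↦ ψ(x, -s)` is non-decreasing on `[0, L)` for `s ≥ 0`. [folklore] -/
lemma monotoneOn_psi_neg_re {s : ℝ} (hs : 0 ≤ s) :
    MonotoneOn (fun x => (S.psi (-(s : ℂ)) x).re) S.dom := by
  intro x hx x' hx' hxx'
  simp only [psi_neg_re]
  refine (S.summable_picard_neg continuous_id s hx).tsum_le_tsum (fun n => ?_)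
    (S.summable_picard_neg continuous_id s hx')
  cases n with
  | zero => simpa using hxx'
  | succ n =>
    exact mul_le_mul_of_nonneg_left
      (S.picard_succ_mono continuous_id (fun _ h => h) n hx.1 hxx' hx') (pow_nonneg hs _)

/-- The first Picard iterate dominates `(t - a) m(a)`: `∫_{[0,t]} (t - u) dm(u) ≥ (t - a) dm([0,a])`
for `0 ≤ a ≤ t < L`. [folklore] -/
lemma sub_mul_mass_le_picard_one {a t : ℝ} (ha : 0 ≤ a) (hat : a ≤ t) (ht : t ∈ S.dom) :
    (t - a) * S.mass a ≤ S.picard (fun _ => (1 : ℝ)) 1 t := by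
  have had : a ∈ S.dom := ⟨ha, (ENNReal.ofReal_le_ofReal hat).trans_lt ht.2⟩
  haveI := S.isFiniteMeasure_restrict_Icc had
  rw [picard_succ, mass_eq_toReal_Icc]
  simp only [picard_zero, mul_one]
  calc (t - a) * (S.massMeasure (Icc 0 a)).toReal = ∫ _ in Icc 0 a, (t - a) ∂S.massMeasure := by
        rw [setIntegral_const, smul_eq_mul, measureReal_def, mul_comm]
    _ ≤ ∫ u in Icc 0 a, (t - u) ∂S.massMeasure :=
        setIntegral_mono_on (integrable_const _)
          (S.integrableOn_Icc_of_continuousOn had (continuousOn_const.sub continuousOn_id))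
          measurableSet_Icc (fun u hu => by linarith [hu.2])
    _ ≤ ∫ u in Icc 0 t, (t - u) ∂S.massMeasure :=
        setIntegral_mono_set
          (S.integrableOn_Icc_of_continuousOn ht (continuousOn_const.sub continuousOn_id))
          (ae_restrict_of_forall_mem measurableSet_Icc fun u hu => sub_nonneg.2 hu.2)
          (Icc_subset_Icc_right hat).eventuallyLE

/-- Linear growth of `φ(·, -s)` past any point: `1 + s (t - a) m(a) ≤ φ(t, -s)` for `s ≥ 0` and
`0 ≤ a ≤ t < L` (the first two terms of the Picard series).
[cite: Tomisaki1988, §4 (proof of Prop. 4.1)] -/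
lemma phi_neg_re_ge {s : ℝ} (hs : 0 ≤ s) {a t : ℝ} (ha : 0 ≤ a) (hat : a ≤ t) (ht : t ∈ S.dom) :
    1 + s * ((t - a) * S.mass a) ≤ (S.phi (-(s : ℂ)) t).re := by
  rw [phi_neg_re]
  have hsum := S.summable_picard_neg continuous_const s ht (f := fun _ => (1 : ℝ))
  calc 1 + s * ((t - a) * S.mass a) ≤ 1 + s * S.picard (fun _ => (1 : ℝ)) 1 t := by
        gcongr
        exact S.sub_mul_mass_le_picard_one ha hat ht
    _ = ∑ n ∈ Finset.range 2, s ^ n * S.picard (fun _ => (1 : ℝ)) n t := by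
        simp [Finset.sum_range_succ]
    _ ≤ ∑' n, s ^ n * S.picard (fun _ => (1 : ℝ)) n t :=
        hsum.sum_le_tsum (Finset.range 2) (fun n _ =>
          mul_nonneg (pow_nonneg hs n) (S.picard_nonneg (fun _ _ => zero_le_one) n ht.1))

/-- Termwise domination of the Picard series: `|φ(x, z)| ≤ φ(x, -|z|)` on `[0, L)`. [folklore] -/
lemma norm_phi_le (z : ℂ) {x : ℝ} (hx : x ∈ S.dom) :
    ‖S.phi z x‖ ≤ (S.phi (-(‖z‖ : ℂ)) x).re := by
  rw [phi_neg_re, phi_eq]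
  have hsum := S.summable_picard_neg continuous_const ‖z‖ hx (f := fun _ => (1 : ℝ))
  have hnorm : ∀ n, ‖(-z) ^ n * (S.picard (fun _ => (1 : ℝ)) n x : ℂ)‖ =
      ‖z‖ ^ n * S.picard (fun _ => (1 : ℝ)) n x := fun n => by
    rw [norm_mul, norm_pow, norm_neg, Complex.norm_real, Real.norm_eq_abs,
      abs_of_nonneg (S.picard_nonneg (fun _ _ => zero_le_one) n hx.1)]
  calc ‖∑' n, (-z) ^ n * (S.picard (fun _ => (1 : ℝ)) n x : ℂ)‖
      ≤ ∑' n, ‖(-z) ^ n * (S.picard (fun _ => (1 : ℝ)) n x : ℂ)‖ :=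
        norm_tsum_le_tsum_norm (hsum.congr (fun n => (hnorm n).symm))
    _ = ∑' n, ‖z‖ ^ n * S.picard (fun _ => (1 : ℝ)) n x := tsum_congr hnorm

/-- Termwise domination of the Picard series: `|ψ(x, z)| ≤ ψ(x, -|z|)` on `[0, L)`. [folklore] -/
lemma norm_psi_le (z : ℂ) {x : ℝ} (hx : x ∈ S.dom) :
    ‖S.psi z x‖ ≤ (S.psi (-(‖z‖ : ℂ)) x).re := by
  rw [psi_neg_re, psi_eq]
  have hsum := S.summable_picard_neg continuous_id ‖z‖ hx (f := fun t => t)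
  have hnorm : ∀ n, ‖(-z) ^ n * (S.picard (fun t => t) n x : ℂ)‖ =
      ‖z‖ ^ n * S.picard (fun t => t) n x := fun n => by
    rw [norm_mul, norm_pow, norm_neg, Complex.norm_real, Real.norm_eq_abs,
      abs_of_nonneg (S.picard_nonneg (fun _ h => h) n hx.1)]
  calc ‖∑' n, (-z) ^ n * (S.picard (fun t => t) n x : ℂ)‖
      ≤ ∑' n, ‖(-z) ^ n * (S.picard (fun t => t) n x : ℂ)‖ :=
        norm_tsum_le_tsum_norm (hsum.congr (fun n => (hnorm n).symm))
    _ = ∑' n, ‖z‖ ^ n * S.picard (fun t => t) n x := tsum_congr hnorm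

/-- `φ(x, z) ≠ 0`-free positivity restated: `φ(x, -s)` is a positive real number for `s ≥ 0`,
`x ∈ [0, L)`. [folklore] -/
lemma phi_neg_ne_zero {s : ℝ} (hs : 0 ≤ s) {x : ℝ} (hx : x ∈ S.dom) : S.phi (-(s : ℂ)) x ≠ 0 := by
  intro h
  have := S.one_le_phi_neg_re hs hx
  rw [h, Complex.zero_re] at this
  exact absurd this (by norm_num)

end KreinString

end Literature.Analysis.InverseSpectral

end
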